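import Summits.CriticalPhenomena.CardyFormulaZ2.Theorems.CardyIKTransportIKMixedBoxCrossingTransportStubCylPlaneChain
import Summits.CriticalPhenomena.CardyFormulaZ2.Theorems.CardyIKTransportIKMixedBoxCrossingTransportStubCylBunch

/-!
# Stub `stub_cylPlane` (line `defect-closure-exploration`, crux `IKMixedBoxCrossing`, stmt-CriticalPhenomena-5911) —
# helper 2: CUTTING THE CYLINDER OPEN (the slab law on a band of rows vs. the planar free box law)

Support file (`--supports stmt-CriticalPhenomena-5911`) for the registered stub `stub_cylPlane : CylPlane`.

* §1 `cylProb` is a probability: nonnegative weights (`CylBunchStub.faceWeight_nonneg` of the sibling stub file), positive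
  partition function, monotone and subadditive in the event.
* §2 ROTATION INVARIANCE `cylProb_preimage_rot`: `x ↦ x(· + m)` preserves the slab weight.
* §3 The PLANAR BOX of `w + 1` cell columns and `h + 1` rows: configurations `Q w h` (colours, flags of the `w × h` inner
  faces), weight `qWt τ q = ∏_{inner faces} faceWeight`, law `qProb`; the band extraction `bandQ L h : CylCfg w L → Q w h`
  (rows `0 … h` of the slab).
* §4 THE CUT (`splitEquiv`): a slab configuration of circumference `L = h + 1 + d'` is its band part and its off-band part
  (`d'` further rows, the flags of the faces of rows `≥ h`); the slab weight is the box weight of the band times the weight of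
  the off-band faces (`cylWeight_glue`), and summing the latter over the off-band data gives the `(d'+1)`-step ROW KERNEL
  between the top and the bottom row of the band (`sum_off`: flags first, then the colour rows one by one = powers of the
  transfer matrix `K τ` of helper 1, `pathSum_eq`).
* §5 `cylProb_bandQ_le`: by the `L∞` mixing of the row kernel (`K_pow_ratio`, factor `5/4` twice), the slab probability of
  any event of the band is at most `2 ×` its planar box probability.
-/

noncomputable section

namespace Summit.CriticalPhenomena.CardyFormulaZ2.Cruxes.IKMixedBoxCrossing.DefectClosureExploration

open scoped BigOperators Classical
open Finset
open Summit.CriticalPhenomena.CardyFormulaZ2.Theorems.IKLinearTransport.PinnedDiagramExchange (faceWeight)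

namespace CylPlane

variable {w L h d' : ℕ}

/-! ## §1 `cylProb` basics -/

/-- Summing the flag out of `faceWeight` gives the colour weight `gf`. -/
theorem sum_faceWeight (iso odd : Bool) : ∑ b : Bool, faceWeight iso odd b = gf iso odd := by
  rw [Fintype.sum_bool]; unfold faceWeight gf; cases iso <;> cases odd <;> norm_num

/-- Slab weights are nonnegative. -/
theorem cylWeight_nonneg' [NeZero L] (τ : Fin w → Bool) (x : CylCfg w L) : 0 ≤ cylWeight w L τ x :=
  Finset.prod_nonneg fun _ _ => CylBunchStub.faceWeight_nonneg _ _ _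

/-- The partition function of the slab is positive (the all-white configuration with all flags `true`). -/
theorem cylZ_pos' [NeZero L] (τ : Fin w → Bool) : 0 < cylZ w L τ := by
  have h0 : 0 < cylWeight w L τ ((fun _ => false), (fun _ => true)) :=
    Finset.prod_pos fun f _ => by unfold faceWeight cylFaceOdd; cases τ f.1 <;> norm_num
  exact lt_of_lt_of_le h0 (Finset.single_le_sum (f := fun x => cylWeight w L τ x)
    (fun x _ => cylWeight_nonneg' τ x) (Finset.mem_univ _))

/-- `cylProb` is monotone in the event. -/
theorem cylProb_mono' [NeZero L] (τ : Fin w → Bool) {E F : Set (CylCfg w L)} (hEF : E ⊆ F) :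
    cylProb w L τ E ≤ cylProb w L τ F := by
  unfold cylProb
  refine div_le_div_of_nonneg_right (Finset.sum_le_sum fun x _ => ?_) (cylZ_pos' τ).le
  by_cases hx : x ∈ E
  · rw [if_pos hx, if_pos (hEF hx)]
  · rw [if_neg hx]; split_ifs; exacts [cylWeight_nonneg' τ x, le_rfl]

/-- `cylProb` is subadditive. -/
theorem cylProb_union_le [NeZero L] (τ : Fin w → Bool) (E F : Set (CylCfg w L)) :
    cylProb w L τ (E ∪ F) ≤ cylProb w L τ E + cylProb w L τ F := by
  unfold cylProb
  rw [← add_div, ← Finset.sum_add_distrib]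
  refine div_le_div_of_nonneg_right (Finset.sum_le_sum fun x _ => ?_) (cylZ_pos' τ).le
  have h0 := cylWeight_nonneg' τ x
  by_cases hE : x ∈ E <;> by_cases hF : x ∈ F <;> simp [hE, hF, h0]

/-- `cylProb` is at most `1`. -/
theorem cylProb_le_one [NeZero L] (τ : Fin w → Bool) (E : Set (CylCfg w L)) : cylProb w L τ E ≤ 1 := by
  unfold cylProb
  rw [div_le_one (cylZ_pos' τ)]
  unfold cylZ
  exact Finset.sum_le_sum fun x _ => by split_ifs; exacts [le_rfl, cylWeight_nonneg' τ x]

/-! ## §2 Rotation invariance -/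

/-- Rotation of a slab configuration by `m` rows: the new configuration reads the old one `m` rows further. -/
def rotCfg (m : ZMod L) (x : CylCfg w L) : CylCfg w L :=
  (fun c => x.1 (c.1, c.2 + m), fun f => x.2 (f.1, f.2 + m))

/-- Rotations compose additively. -/
theorem rotCfg_add (m m' : ZMod L) (x : CylCfg w L) : rotCfg m (rotCfg m' x) = rotCfg (m + m') x := by
  refine Prod.ext (funext fun c => ?_) (funext fun f => ?_) <;> simp [rotCfg, add_assoc]

/-- Rotation by `0` is the identity. -/
theorem rotCfg_zero (x : CylCfg w L) : rotCfg (0 : ZMod L) x = x := by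
  refine Prod.ext (funext fun c => ?_) (funext fun f => ?_) <;> simp [rotCfg]

/-- Rotation as a permutation of the configurations. -/
def rotEquiv (m : ZMod L) : CylCfg w L ≃ CylCfg w L where
  toFun := rotCfg m
  invFun := rotCfg (-m)
  left_inv x := by rw [rotCfg_add, neg_add_cancel, rotCfg_zero]
  right_inv x := by rw [rotCfg_add, add_neg_cancel, rotCfg_zero]

/-- Face parities rotate along. -/
theorem cylFaceOdd_rot (m : ZMod L) (x : CylCfg w L) (f : Fin w × ZMod L) :
    cylFaceOdd (rotCfg m x).1 f = cylFaceOdd x.1 (f.1, f.2 + m) := by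
  simp only [cylFaceOdd, rotCfg, add_right_comm f.2 1 m]

/-- The slab weight is rotation invariant. -/
theorem cylWeight_rot [NeZero L] (τ : Fin w → Bool) (m : ZMod L) (x : CylCfg w L) :
    cylWeight w L τ (rotCfg m x) = cylWeight w L τ x := by
  unfold cylWeight
  refine Fintype.prod_equiv (Equiv.prodCongr (Equiv.refl _) (Equiv.addRight m)) _ _ fun f => ?_
  obtain ⟨j, r⟩ := f
  show faceWeight (τ j) (cylFaceOdd (rotCfg m x).1 (j, r)) ((rotCfg m x).2 (j, r)) =
    faceWeight (τ j) (cylFaceOdd x.1 (j, r + m)) (x.2 (j, r + m))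
  rw [cylFaceOdd_rot]
  rfl

/-- **Rotation invariance of the slab law.** -/
theorem cylProb_preimage_rot [NeZero L] (τ : Fin w → Bool) (m : ZMod L) (E : Set (CylCfg w L)) :
    cylProb w L τ (rotCfg m ⁻¹' E) = cylProb w L τ E := by
  unfold cylProb
  congr 1
  exact Fintype.sum_equiv (rotEquiv m) _ _ fun x => by
    simp only [Set.mem_preimage, rotEquiv, Equiv.coe_fn_mk, cylWeight_rot]

/-! ## §3 The planar box: configurations, weight, law; the band of the slab -/

/-- Configurations of the planar box of `w + 1` cell columns and `h + 1` rows: colours of the cells, flags of the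
`w × h` inner faces (face `(j, s)` has corners `(j,s), (j+1,s), (j,s+1), (j+1,s+1)`). -/
abbrev Q (w h : ℕ) : Type := (Fin (w + 1) × Fin (h + 1) → Bool) × (Fin w × Fin h → Bool)

/-- Parity of an inner face of the box (verbatim `BridgeLawStub.fpar`). -/
def qpar (c : Fin (w + 1) × Fin (h + 1) → Bool) (p : Fin w × Fin h) : Bool :=
  (c (p.1.castSucc, p.2.castSucc) ^^ c (p.1.succ, p.2.castSucc)) ^^ (c (p.1.castSucc, p.2.succ) ^^ c (p.1.succ, p.2.succ))

/-- The planar free box weight: the product of the local face weights over the inner faces. -/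
def qWt (τ : Fin w → Bool) (q : Q w h) : ℝ := ∏ p : Fin w × Fin h, faceWeight (τ p.1) (qpar q.1 p) (q.2 p)

/-- Its partition function. -/
def qZ (τ : Fin w → Bool) (h : ℕ) : ℝ := ∑ q : Q w h, qWt τ q

/-- The planar free box law. -/
def qProb (τ : Fin w → Bool) (E : Set (Q w h)) : ℝ := (∑ q : Q w h, if q ∈ E then qWt τ q else 0) / qZ τ h

/-- Box weights are nonnegative. -/
theorem qWt_nonneg (τ : Fin w → Bool) (q : Q w h) : 0 ≤ qWt τ q :=
  Finset.prod_nonneg fun _ _ => CylBunchStub.faceWeight_nonneg _ _ _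

/-- The box partition function is positive. -/
theorem qZ_pos (τ : Fin w → Bool) (h : ℕ) : 0 < qZ τ h := by
  have h0 : 0 < qWt τ (((fun _ => false), (fun _ => true)) : Q w h) :=
    Finset.prod_pos fun p _ => by unfold faceWeight qpar; cases τ p.1 <;> norm_num
  exact lt_of_lt_of_le h0 (Finset.single_le_sum (f := fun q => qWt τ q) (fun q _ => qWt_nonneg τ q)
    (Finset.mem_univ _))

/-- `qProb` is nonnegative. -/
theorem qProb_nonneg (τ : Fin w → Bool) (E : Set (Q w h)) : 0 ≤ qProb τ E :=
  div_nonneg (Finset.sum_nonneg fun q _ => by split_ifs; exacts [qWt_nonneg τ q, le_rfl]) (qZ_pos τ h).le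

/-- The BAND of the slab: its rows `0 … h` read as a planar box configuration. -/
def bandQ (L h : ℕ) (x : CylCfg w L) : Q w h :=
  (fun p => x.1 (p.1, ((p.2 : ℕ) : ZMod L)), fun p => x.2 (p.1, ((p.2 : ℕ) : ZMod L)))

/-- Top row of a box configuration. -/
def topRow (q : Q w h) : Row w := fun i => q.1 (i, Fin.last h)

/-- Bottom row of a box configuration. -/
def botRow (q : Q w h) : Row w := fun i => q.1 (i, 0)

/-! ## §4 The cut: band part, off-band part, and the off-band sum -/

/-- `(r + 1).val = r.val + 1` away from the seam. -/
theorem val_add_one [NeZero L] (r : ZMod L) (hr : r.val + 1 < L) : (r + 1).val = r.val + 1 := by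
  haveI : Fact (1 < L) := ⟨by omega⟩
  rw [ZMod.val_add_of_lt (by rw [ZMod.val_one]; exact hr), ZMod.val_one]

/-- `r + 1 = 0` at the seam. -/
theorem add_one_eq_zero [NeZero L] (r : ZMod L) (hr : r.val + 1 = L) : r + 1 = 0 := by
  rw [← ZMod.natCast_zmod_val r, ← Nat.cast_add_one, hr, ZMod.natCast_self]

/-- OFF-BAND DATA for `L = h + 1 + d'`: the colours of the `d'` rows `h+1 … L-1` and the flags of the faces of the rows `≥ h`. -/
abbrev Off (w L h d' : ℕ) : Type := (Fin d' → Row w) × ({f : Fin w × ZMod L // ¬ f.2.val < h} → Bool)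

/-- Gluing a band part and off-band colour rows into a slab colouring. -/
def glueCol [NeZero L] (hL : L = h + 1 + d') (q : Q w h) (o1 : Fin d' → Row w) : Fin (w + 1) × ZMod L → Bool :=
  fun c => if hc : c.2.val ≤ h then q.1 (c.1, ⟨c.2.val, Nat.lt_succ_of_le hc⟩)
    else o1 ⟨c.2.val - (h + 1), by have := ZMod.val_lt c.2; omega⟩ c.1

/-- Gluing a band part and an off-band part into a slab configuration (flags). -/
def glue [NeZero L] (hL : L = h + 1 + d') (q : Q w h) (o : Off w L h d') : CylCfg w L :=
  (glueCol hL q o.1, fun f => if hf : f.2.val < h then q.2 (f.1, ⟨f.2.val, hf⟩) else o.2 ⟨f, hf⟩)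

/-- The off-band part of a slab configuration. -/
def offOf (L h d' : ℕ) (x : CylCfg w L) : Off w L h d' :=
  (fun i c1 => x.1 (c1, ((h + 1 + (i : ℕ) : ℕ) : ZMod L)), fun f => x.2 f.1)

section Glue

variable [NeZero L] (hL : L = h + 1 + d') (τ : Fin w → Bool) (q : Q w h) (o : Off w L h d')

/-- Colours of a glued configuration in the band. -/
theorem glue_fst_of_le (c1 : Fin (w + 1)) (r : ZMod L) (s : Fin (h + 1)) (hs : r.val = s.val) :
    glueCol hL q o.1 (c1, r) = q.1 (c1, s) := by
  simp only [glueCol]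
  rw [dif_pos (by omega)]
  exact congrArg _ (Prod.ext rfl (Fin.ext hs))

/-- Colours of a glued configuration off the band. -/
theorem glue_fst_of_gt (c1 : Fin (w + 1)) (r : ZMod L) (i : Fin d') (hi : r.val = h + 1 + i.val) :
    glueCol hL q o.1 (c1, r) = o.1 i c1 := by
  simp only [glueCol]
  rw [dif_neg (by omega)]
  exact congrFun (congrArg _ (Fin.ext (by simp only; omega))) _

/-- Flags of a glued configuration in the band. -/
theorem glue_snd_of_lt (j : Fin w) (r : ZMod L) (s : Fin h) (hs : r.val = s.val) :
    (glue hL q o).2 (j, r) = q.2 (j, s) := by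
  simp only [glue]
  rw [dif_pos (by omega)]
  exact congrArg _ (Prod.ext rfl (Fin.ext hs))

/-- Flags of a glued configuration off the band. -/
theorem glue_snd_of_ge (f : {f : Fin w × ZMod L // ¬ f.2.val < h}) : (glue hL q o).2 f.1 = o.2 f := by
  simp only [glue]
  rw [dif_neg f.2]

/-- **The cut**: slab configurations ↔ (band part, off-band part). -/
def splitEquiv : CylCfg w L ≃ Q w h × Off w L h d' where
  toFun x := (bandQ L h x, offOf L h d' x)
  invFun p := glue hL p.1 p.2
  left_inv x := by
    refine Prod.ext (funext fun c => ?_) (funext fun f => ?_)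
    · obtain ⟨c1, r⟩ := c
      show glueCol hL (bandQ L h x) (offOf L h d' x).1 (c1, r) = x.1 (c1, r)
      by_cases hr : r.val ≤ h
      · rw [glue_fst_of_le hL _ _ c1 r ⟨r.val, by omega⟩ rfl]
        simp [bandQ]
      · rw [glue_fst_of_gt hL _ _ c1 r ⟨r.val - (h + 1), by have := ZMod.val_lt r; omega⟩ (by simp; omega)]
        simp only [offOf]
        rw [show h + 1 + (r.val - (h + 1)) = r.val by omega, ZMod.natCast_zmod_val]
    · obtain ⟨j, r⟩ := f
      by_cases hr : r.val < h
      · rw [glue_snd_of_lt hL _ _ j r ⟨r.val, hr⟩ rfl]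
        simp [bandQ]
      · exact glue_snd_of_ge hL _ _ ⟨(j, r), hr⟩
  right_inv p := by
    obtain ⟨q, o⟩ := p
    have hval : ∀ m : ℕ, m < L → ((m : ℕ) : ZMod L).val = m := fun m hm => ZMod.val_cast_of_lt hm
    refine Prod.ext (Prod.ext (funext fun c => ?_) (funext fun f => ?_))
      (Prod.ext (funext fun i => funext fun c1 => ?_) (funext fun f => ?_))
    · exact glue_fst_of_le hL q o c.1 _ c.2 (hval _ (by omega))
    · exact glue_snd_of_lt hL q o f.1 _ f.2 (hval _ (by omega))
    · exact glue_fst_of_gt hL q o c1 _ i (hval _ (by omega))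
    · exact glue_snd_of_ge hL q o f

/-- The band part of a glued configuration. -/
theorem bandQ_glue : bandQ L h (glue hL q o) = q := congrArg Prod.fst ((splitEquiv hL).right_inv (q, o))

/-- The band faces ↔ the inner faces of the box. -/
def bandFaceEquiv : {f : Fin w × ZMod L // f.2.val < h} ≃ Fin w × Fin h where
  toFun f := (f.1.1, ⟨f.1.2.val, f.2⟩)
  invFun p := ⟨(p.1, ((p.2 : ℕ) : ZMod L)), by
    show ((p.2 : ℕ) : ZMod L).val < h
    rw [ZMod.val_cast_of_lt (by omega)]; exact p.2.isLt⟩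
  left_inv f := Subtype.ext (Prod.ext rfl (ZMod.natCast_zmod_val f.1.2))
  right_inv p := Prod.ext rfl (Fin.ext (ZMod.val_cast_of_lt (by omega)))

/-- The off-band faces ↔ (face column, face row `h + i`, `i ≤ d'`). -/
def offFaceEquiv : {f : Fin w × ZMod L // ¬ f.2.val < h} ≃ Fin w × Fin (d' + 1) where
  toFun f := (f.1.1, ⟨f.1.2.val - h, by have := ZMod.val_lt f.1.2; omega⟩)
  invFun p := ⟨(p.1, ((h + (p.2 : ℕ) : ℕ) : ZMod L)), by
    show ¬ ((h + (p.2 : ℕ) : ℕ) : ZMod L).val < h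
    rw [ZMod.val_cast_of_lt (by omega)]; omega⟩
  left_inv f := Subtype.ext (Prod.ext rfl (by
    show (((h + (f.1.2.val - h) : ℕ)) : ZMod L) = f.1.2
    rw [show h + (f.1.2.val - h) = f.1.2.val by have := f.2; omega, ZMod.natCast_zmod_val]))
  right_inv p := Prod.ext rfl (Fin.ext (by
    show ((h + (p.2 : ℕ) : ℕ) : ZMod L).val - h = p.2
    rw [ZMod.val_cast_of_lt (by omega)]; omega))

/-- The weight of the band faces of a glued configuration is the box weight of the band part. -/
theorem prod_band : ∏ f : {f : Fin w × ZMod L // f.2.val < h},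
    faceWeight (τ f.1.1) (cylFaceOdd (glueCol hL q o.1) f.1) ((glue hL q o).2 f.1) = qWt τ q := by
  unfold qWt
  refine Fintype.prod_equiv (bandFaceEquiv hL) _ _ fun f => ?_
  obtain ⟨⟨j, r⟩, hr⟩ := f
  have hr' : r.val < h := hr
  have hr1 : (r + 1).val = r.val + 1 := val_add_one r (by omega)
  show faceWeight (τ j) (cylFaceOdd (glueCol hL q o.1) (j, r)) ((glue hL q o).2 (j, r)) =
    faceWeight (τ j) (qpar q.1 (j, ⟨r.val, hr'⟩)) (q.2 (j, ⟨r.val, hr'⟩))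
  congr 1
  · simp only [cylFaceOdd, qpar]
    rw [glue_fst_of_le hL q o _ r ⟨r.val, by omega⟩ rfl, glue_fst_of_le hL q o _ r ⟨r.val, by omega⟩ rfl,
      glue_fst_of_le hL q o _ (r + 1) ⟨r.val + 1, by omega⟩ hr1,
      glue_fst_of_le hL q o _ (r + 1) ⟨r.val + 1, by omega⟩ hr1]
    rfl
  · exact glue_snd_of_lt hL q o j r ⟨r.val, hr'⟩ rfl

/-- The slab weight of a glued configuration: box weight of the band × weight of the off-band faces. -/
theorem cylWeight_glue : cylWeight w L τ (glue hL q o) = qWt τ q *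
    ∏ f : {f : Fin w × ZMod L // ¬ f.2.val < h}, faceWeight (τ f.1.1) (cylFaceOdd (glueCol hL q o.1) f.1) (o.2 f) := by
  show ∏ f, faceWeight (τ f.1) (cylFaceOdd (glueCol hL q o.1) f) ((glue hL q o).2 f) = _
  rw [← Fintype.prod_subtype_mul_prod_subtype (fun f : Fin w × ZMod L => f.2.val < h), prod_band]
  congr 1
  exact Fintype.prod_congr _ _ fun f => by rw [glue_snd_of_ge]

end Glue

end CylPlane

/-- **Registered helper `cylPlane_cylWeight_glue`** (line `defect-closure-exploration`, stub `stub_cylPlane`, step (iii), the cut):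
the slab weight of the gluing of a band part `q` and an off-band part `o` is the planar box weight of `q` times the weight of
the off-band faces. -/
theorem cylPlane_cylWeight_glue : ∀ {w L h d' : ℕ} [NeZero L] (hL : L = h + 1 + d') (τ : Fin w → Bool) (q : CylPlane.Q w h)
    (o : CylPlane.Off w L h d'), cylWeight w L τ (CylPlane.glue hL q o) = CylPlane.qWt τ q *
      ∏ f : {f : Fin w × ZMod L // ¬ f.2.val < h}, faceWeight (τ f.1.1) (cylFaceOdd (CylPlane.glueCol hL q o.1) f.1) (o.2 f) :=
  fun hL τ q o => CylPlane.cylWeight_glue hL τ q o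

end Summit.CriticalPhenomena.CardyFormulaZ2.Cruxes.IKMixedBoxCrossing.DefectClosureExploration

end
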